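import Summits.RiemannHypothesis.RiemannHypothesis.Theorems.SemilocalLogAtomsB
import Summits.RiemannHypothesis.RiemannHypothesis.Theorems.SemilocalLogAtomsE
import HarnessLib

/-!
# Log-atom enclosures (L): the atoms `131`, `137`, `139`, `149`, `151`

Cell `rh-explicit` (HOME `run/shared/lean/pub/rh-explicit/`), seat cc-s2-4 gen11 (A4 lane, the Lean side).  Sequel of
`SemilocalLogAtoms{,B,…,K}.lean`: the rational enclosures `(lo, hi, wlo, whi)` of `log p` and of the weights `log p/√p` for
`p = 131, 137, 139, 149, 151` — the atoms (and, through the `lo` fields, the window-end bounds `log 139`, `log 149`, `log 151`)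
needed by the NEXT wall rows beyond `q = 131`: the twin-prime walls `q = 137` (`S = {p ≤ 131}`, window `< (log 139)/2`, kinked class,
18 slope breaks per `HOME/cc-s2-4/gen10/kinked101/KINKED-101-NOTE.md`) and `q = 149` (`< (log 151)/2`, 24 breaks), and the polynomial
walls `q = 139` (`< (log 149)/2`) and `q = 151` (`< (log 157)/2`).  7-term log series (`Real.abs_log_sub_add_sum_range_le`) at
`130·(1+1/130)`, `136·(1+1/136)`, `140·(1−1/140)`, `150·(1∓1/150)` with the tree's `log 2, 3, 5, 7, 13, 17`; square roots by squaring.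
Folklore numerics throughout; nothing here bears on RH.
-/

set_option autoImplicit false
set_option linter.dupNamespace false  -- the mandated namespace repeats `RiemannHypothesis`

noncomputable section

namespace Summit.RiemannHypothesis.RiemannHypothesis.Theorems.SemilocalPolyWitness

open Real
open Literature.NumberTheory.LFunctions
open Literature.Analysis.SpecialFunctions.Real
open Summit.RiemannHypothesis.RiemannHypothesis.Theorems.MotivicDoor.SemilocalMarkov

/-! ### The atom `131` (`log 131` from `131 = 130·(1 + 1/130)`) -/

/-- `(4.87519732309) < log 131` (`Real.abs_log_sub_add_sum_range_le` at `x = -1/130`, 7 terms). -/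
theorem log_hundredthirtyone_gt : (4.87519732309 : ℝ) < Real.log 131 := by
  have t : |(-(1 : ℝ) / 130)| < 1 := by rw [abs_of_neg (by norm_num)]; norm_num
  have z := Real.abs_log_sub_add_sum_range_le t 7
  rw [show |(-(1 : ℝ) / 130)| = 1 / 130 by rw [abs_of_neg (by norm_num)]; norm_num] at z
  norm_num [Finset.sum_range_succ] at z
  have e : Real.log (131 / 130) = Real.log 131 - (Real.log 2 + Real.log 5 + Real.log 13) := by
    rw [Real.log_div (by norm_num) (by norm_num), show (130 : ℝ) = 2 * 5 * 13 by norm_num, Real.log_mul (by norm_num) (by norm_num), Real.log_mul (by norm_num) (by norm_num)]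
  rw [e] at z
  have h2 := Literature.Analysis.SpecialFunctions.Real.log_two_gt_d20
  have h5 := logFiveLo_le
  rw [logFiveLo] at h5
  push_cast at h5
  have h13 := logThirteenLo_le
  rw [logThirteenLo] at h13
  push_cast at h13
  obtain ⟨z1, z2⟩ := abs_le.1 z
  linarith

/-- `log 131 < 4.87519732331` (`Real.abs_log_sub_add_sum_range_le` at `x = -1/130`, 7 terms). -/
theorem log_hundredthirtyone_lt : Real.log 131 < 4.87519732331 := by
  have t : |(-(1 : ℝ) / 130)| < 1 := by rw [abs_of_neg (by norm_num)]; norm_num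
  have z := Real.abs_log_sub_add_sum_range_le t 7
  rw [show |(-(1 : ℝ) / 130)| = 1 / 130 by rw [abs_of_neg (by norm_num)]; norm_num] at z
  norm_num [Finset.sum_range_succ] at z
  have e : Real.log (131 / 130) = Real.log 131 - (Real.log 2 + Real.log 5 + Real.log 13) := by
    rw [Real.log_div (by norm_num) (by norm_num), show (130 : ℝ) = 2 * 5 * 13 by norm_num, Real.log_mul (by norm_num) (by norm_num), Real.log_mul (by norm_num) (by norm_num)]
  rw [e] at z
  have h2 := Literature.Analysis.SpecialFunctions.Real.log_two_lt_d20
  have h5 := log_five_le_logFiveHi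
  rw [logFiveHi] at h5
  push_cast at h5
  have h13 := log_thirteen_le_logThirteenHi
  rw [logThirteenHi] at h13
  push_cast at h13
  obtain ⟨z1, z2⟩ := abs_le.1 z
  linarith

/-- lower decimal of `log 131` (fine) -/
def logHundredThirtyOneLo11 : ℚ := 487519732309 / 100000000000
/-- upper decimal of `log 131` -/
def logHundredThirtyOneHi11 : ℚ := 487519732331 / 100000000000
/-- `logHundredThirtyOneLo11 ≤ log 131`. -/
theorem logHundredThirtyOneLo11_le : (logHundredThirtyOneLo11 : ℝ) ≤ Real.log 131 := by
  rw [logHundredThirtyOneLo11]; push_cast; linarith [log_hundredthirtyone_gt]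
/-- `log 131 ≤ logHundredThirtyOneHi11`. -/
theorem log_hundredthirtyone_le_logHundredThirtyOneHi11 : Real.log 131 ≤ (logHundredThirtyOneHi11 : ℝ) := by
  rw [logHundredThirtyOneHi11]; push_cast; linarith [log_hundredthirtyone_lt]
/-- `11.445523142259598 ≤ √131 ≤ 11.445523142259598`. -/
def sqrtHundredThirtyOneLo : ℚ := 114455231422595970 / 10000000000000000
/-- upper decimal of `√131` -/
def sqrtHundredThirtyOneHi : ℚ := 114455231422595971 / 10000000000000000
/-- The atom `131`: weight `log 131/√131`. -/
def atomHundredThirtyOne : ℕ × AtomQ :=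
  (131, ⟨logHundredThirtyOneLo11, logHundredThirtyOneHi11, logHundredThirtyOneLo11 / sqrtHundredThirtyOneHi, logHundredThirtyOneHi11 / sqrtHundredThirtyOneLo⟩)
/-- `atomHundredThirtyOne` encloses the atom `131` for any `S ∋ 131`. -/
theorem atomHundredThirtyOne_encl {S : Finset ℕ} (h : 131 ∈ S) :
    (atomHundredThirtyOne.2.lo : ℝ) ≤ Real.log atomHundredThirtyOne.1 ∧ Real.log atomHundredThirtyOne.1 ≤ (atomHundredThirtyOne.2.hi : ℝ) ∧
      (atomHundredThirtyOne.2.wlo : ℝ) ≤ weilSemilocalCoeff S atomHundredThirtyOne.1 ∧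
      weilSemilocalCoeff S atomHundredThirtyOne.1 ≤ (atomHundredThirtyOne.2.whi : ℝ) := by
  simp only [atomHundredThirtyOne]
  push_cast
  have h0 := prime_atom_encl (by norm_num : Nat.Prime 131) h (lo := logHundredThirtyOneLo11) (hi := logHundredThirtyOneHi11)
    (slo := sqrtHundredThirtyOneLo) (shi := sqrtHundredThirtyOneHi) (by exact_mod_cast logHundredThirtyOneLo11_le)
    (by exact_mod_cast log_hundredthirtyone_le_logHundredThirtyOneHi11) (by rw [logHundredThirtyOneLo11]; norm_num)
    (ratCast_le_sqrt (by rw [sqrtHundredThirtyOneLo]; norm_num) (by rw [sqrtHundredThirtyOneLo]; norm_num))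
    (sqrt_le_ratCast (by rw [sqrtHundredThirtyOneHi]; norm_num) (by rw [sqrtHundredThirtyOneHi]; norm_num))
    (by rw [sqrtHundredThirtyOneLo]; norm_num)
  push_cast at h0
  exact h0

/-! ### The atom `137` (`log 137` from `137 = 136·(1 + 1/136)`) -/

/-- `(4.91998092582) < log 137` (`Real.abs_log_sub_add_sum_range_le` at `x = -1/136`, 7 terms). -/
theorem log_hundredthirtyseven_gt : (4.91998092582 : ℝ) < Real.log 137 := by
  have t : |(-(1 : ℝ) / 136)| < 1 := by rw [abs_of_neg (by norm_num)]; norm_num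
  have z := Real.abs_log_sub_add_sum_range_le t 7
  rw [show |(-(1 : ℝ) / 136)| = 1 / 136 by rw [abs_of_neg (by norm_num)]; norm_num] at z
  norm_num [Finset.sum_range_succ] at z
  have e : Real.log (137 / 136) = Real.log 137 - (3 * Real.log 2 + Real.log 17) := by
    rw [Real.log_div (by norm_num) (by norm_num), show (136 : ℝ) = 2 ^ 3 * 17 by norm_num, Real.log_mul (by norm_num) (by norm_num), Real.log_pow]
    push_cast; ring
  rw [e] at z
  have h2 := Literature.Analysis.SpecialFunctions.Real.log_two_gt_d20
  have h17 := logSeventeenLo_le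
  rw [logSeventeenLo] at h17
  push_cast at h17
  obtain ⟨z1, z2⟩ := abs_le.1 z
  linarith

/-- `log 137 < 4.91998092584` (`Real.abs_log_sub_add_sum_range_le` at `x = -1/136`, 7 terms). -/
theorem log_hundredthirtyseven_lt : Real.log 137 < 4.91998092584 := by
  have t : |(-(1 : ℝ) / 136)| < 1 := by rw [abs_of_neg (by norm_num)]; norm_num
  have z := Real.abs_log_sub_add_sum_range_le t 7
  rw [show |(-(1 : ℝ) / 136)| = 1 / 136 by rw [abs_of_neg (by norm_num)]; norm_num] at z
  norm_num [Finset.sum_range_succ] at z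
  have e : Real.log (137 / 136) = Real.log 137 - (3 * Real.log 2 + Real.log 17) := by
    rw [Real.log_div (by norm_num) (by norm_num), show (136 : ℝ) = 2 ^ 3 * 17 by norm_num, Real.log_mul (by norm_num) (by norm_num), Real.log_pow]
    push_cast; ring
  rw [e] at z
  have h2 := Literature.Analysis.SpecialFunctions.Real.log_two_lt_d20
  have h17 := log_seventeen_le_logSeventeenHi
  rw [logSeventeenHi] at h17
  push_cast at h17
  obtain ⟨z1, z2⟩ := abs_le.1 z
  linarith

/-- lower decimal of `log 137` (fine) -/
def logHundredThirtySevenLo11 : ℚ := 491998092582 / 100000000000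
/-- upper decimal of `log 137` -/
def logHundredThirtySevenHi11 : ℚ := 491998092584 / 100000000000
/-- `logHundredThirtySevenLo11 ≤ log 137`. -/
theorem logHundredThirtySevenLo11_le : (logHundredThirtySevenLo11 : ℝ) ≤ Real.log 137 := by
  rw [logHundredThirtySevenLo11]; push_cast; linarith [log_hundredthirtyseven_gt]
/-- `log 137 ≤ logHundredThirtySevenHi11`. -/
theorem log_hundredthirtyseven_le_logHundredThirtySevenHi11 : Real.log 137 ≤ (logHundredThirtySevenHi11 : ℝ) := by
  rw [logHundredThirtySevenHi11]; push_cast; linarith [log_hundredthirtyseven_lt]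
/-- `11.704699910719626 ≤ √137 ≤ 11.704699910719626`. -/
def sqrtHundredThirtySevenLo : ℚ := 117046999107196251 / 10000000000000000
/-- upper decimal of `√137` -/
def sqrtHundredThirtySevenHi : ℚ := 117046999107196252 / 10000000000000000
/-- The atom `137`: weight `log 137/√137`. -/
def atomHundredThirtySeven : ℕ × AtomQ :=
  (137, ⟨logHundredThirtySevenLo11, logHundredThirtySevenHi11, logHundredThirtySevenLo11 / sqrtHundredThirtySevenHi, logHundredThirtySevenHi11 / sqrtHundredThirtySevenLo⟩)
/-- `atomHundredThirtySeven` encloses the atom `137` for any `S ∋ 137`. -/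
theorem atomHundredThirtySeven_encl {S : Finset ℕ} (h : 137 ∈ S) :
    (atomHundredThirtySeven.2.lo : ℝ) ≤ Real.log atomHundredThirtySeven.1 ∧ Real.log atomHundredThirtySeven.1 ≤ (atomHundredThirtySeven.2.hi : ℝ) ∧
      (atomHundredThirtySeven.2.wlo : ℝ) ≤ weilSemilocalCoeff S atomHundredThirtySeven.1 ∧
      weilSemilocalCoeff S atomHundredThirtySeven.1 ≤ (atomHundredThirtySeven.2.whi : ℝ) := by
  simp only [atomHundredThirtySeven]
  push_cast
  have h0 := prime_atom_encl (by norm_num : Nat.Prime 137) h (lo := logHundredThirtySevenLo11) (hi := logHundredThirtySevenHi11)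
    (slo := sqrtHundredThirtySevenLo) (shi := sqrtHundredThirtySevenHi) (by exact_mod_cast logHundredThirtySevenLo11_le)
    (by exact_mod_cast log_hundredthirtyseven_le_logHundredThirtySevenHi11) (by rw [logHundredThirtySevenLo11]; norm_num)
    (ratCast_le_sqrt (by rw [sqrtHundredThirtySevenLo]; norm_num) (by rw [sqrtHundredThirtySevenLo]; norm_num))
    (sqrt_le_ratCast (by rw [sqrtHundredThirtySevenHi]; norm_num) (by rw [sqrtHundredThirtySevenHi]; norm_num))
    (by rw [sqrtHundredThirtySevenLo]; norm_num)
  push_cast at h0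
  exact h0

/-! ### The atom `139` (`log 139` from `139 = 140·(1 − 1/140)`) -/

/-- `(4.93447393302) < log 139` (`Real.abs_log_sub_add_sum_range_le` at `x = 1/140`, 7 terms). -/
theorem log_hundredthirtynine_gt : (4.93447393302 : ℝ) < Real.log 139 := by
  have t : |((1 : ℝ) / 140)| < 1 := by rw [abs_of_pos (by norm_num)]; norm_num
  have z := Real.abs_log_sub_add_sum_range_le t 7
  rw [abs_of_pos (by norm_num : (0 : ℝ) < 1 / 140)] at z
  norm_num [Finset.sum_range_succ] at z
  have e : Real.log (139 / 140) = Real.log 139 - (2 * Real.log 2 + Real.log 5 + Real.log 7) := by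
    rw [Real.log_div (by norm_num) (by norm_num), show (140 : ℝ) = 2 ^ 2 * 5 * 7 by norm_num, Real.log_mul (by norm_num) (by norm_num), Real.log_mul (by norm_num) (by norm_num), Real.log_pow]
    push_cast; ring
  rw [e] at z
  have h2 := Literature.Analysis.SpecialFunctions.Real.log_two_gt_d20
  have h5 := logFiveLo_le
  rw [logFiveLo] at h5
  push_cast at h5
  have h7 := logSevenLo_le
  rw [logSevenLo] at h7
  push_cast at h7
  obtain ⟨z1, z2⟩ := abs_le.1 z
  linarith

/-- `log 139 < 4.93447393324` (`Real.abs_log_sub_add_sum_range_le` at `x = 1/140`, 7 terms). -/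
theorem log_hundredthirtynine_lt : Real.log 139 < 4.93447393324 := by
  have t : |((1 : ℝ) / 140)| < 1 := by rw [abs_of_pos (by norm_num)]; norm_num
  have z := Real.abs_log_sub_add_sum_range_le t 7
  rw [abs_of_pos (by norm_num : (0 : ℝ) < 1 / 140)] at z
  norm_num [Finset.sum_range_succ] at z
  have e : Real.log (139 / 140) = Real.log 139 - (2 * Real.log 2 + Real.log 5 + Real.log 7) := by
    rw [Real.log_div (by norm_num) (by norm_num), show (140 : ℝ) = 2 ^ 2 * 5 * 7 by norm_num, Real.log_mul (by norm_num) (by norm_num), Real.log_mul (by norm_num) (by norm_num), Real.log_pow]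
    push_cast; ring
  rw [e] at z
  have h2 := Literature.Analysis.SpecialFunctions.Real.log_two_lt_d20
  have h5 := log_five_le_logFiveHi
  rw [logFiveHi] at h5
  push_cast at h5
  have h7 := log_seven_le_logSevenHi
  rw [logSevenHi] at h7
  push_cast at h7
  obtain ⟨z1, z2⟩ := abs_le.1 z
  linarith

/-- lower decimal of `log 139` (fine) -/
def logHundredThirtyNineLo11 : ℚ := 493447393302 / 100000000000
/-- upper decimal of `log 139` -/
def logHundredThirtyNineHi11 : ℚ := 493447393324 / 100000000000
/-- `logHundredThirtyNineLo11 ≤ log 139`. -/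
theorem logHundredThirtyNineLo11_le : (logHundredThirtyNineLo11 : ℝ) ≤ Real.log 139 := by
  rw [logHundredThirtyNineLo11]; push_cast; linarith [log_hundredthirtynine_gt]
/-- `log 139 ≤ logHundredThirtyNineHi11`. -/
theorem log_hundredthirtynine_le_logHundredThirtyNineHi11 : Real.log 139 ≤ (logHundredThirtyNineHi11 : ℝ) := by
  rw [logHundredThirtyNineHi11]; push_cast; linarith [log_hundredthirtynine_lt]
/-- `11.789826122551595 ≤ √139 ≤ 11.789826122551595`. -/
def sqrtHundredThirtyNineLo : ℚ := 117898261225515959 / 10000000000000000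
/-- upper decimal of `√139` -/
def sqrtHundredThirtyNineHi : ℚ := 117898261225515960 / 10000000000000000
/-- The atom `139`: weight `log 139/√139`. -/
def atomHundredThirtyNine : ℕ × AtomQ :=
  (139, ⟨logHundredThirtyNineLo11, logHundredThirtyNineHi11, logHundredThirtyNineLo11 / sqrtHundredThirtyNineHi, logHundredThirtyNineHi11 / sqrtHundredThirtyNineLo⟩)
/-- `atomHundredThirtyNine` encloses the atom `139` for any `S ∋ 139`. -/
theorem atomHundredThirtyNine_encl {S : Finset ℕ} (h : 139 ∈ S) :
    (atomHundredThirtyNine.2.lo : ℝ) ≤ Real.log atomHundredThirtyNine.1 ∧ Real.log atomHundredThirtyNine.1 ≤ (atomHundredThirtyNine.2.hi : ℝ) ∧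
      (atomHundredThirtyNine.2.wlo : ℝ) ≤ weilSemilocalCoeff S atomHundredThirtyNine.1 ∧
      weilSemilocalCoeff S atomHundredThirtyNine.1 ≤ (atomHundredThirtyNine.2.whi : ℝ) := by
  simp only [atomHundredThirtyNine]
  push_cast
  have h0 := prime_atom_encl (by norm_num : Nat.Prime 139) h (lo := logHundredThirtyNineLo11) (hi := logHundredThirtyNineHi11)
    (slo := sqrtHundredThirtyNineLo) (shi := sqrtHundredThirtyNineHi) (by exact_mod_cast logHundredThirtyNineLo11_le)
    (by exact_mod_cast log_hundredthirtynine_le_logHundredThirtyNineHi11) (by rw [logHundredThirtyNineLo11]; norm_num)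
    (ratCast_le_sqrt (by rw [sqrtHundredThirtyNineLo]; norm_num) (by rw [sqrtHundredThirtyNineLo]; norm_num))
    (sqrt_le_ratCast (by rw [sqrtHundredThirtyNineHi]; norm_num) (by rw [sqrtHundredThirtyNineHi]; norm_num))
    (by rw [sqrtHundredThirtyNineLo]; norm_num)
  push_cast at h0
  exact h0

/-! ### The atom `149` (`log 149` from `149 = 150·(1 − 1/150)`) -/

/-- `(5.00394630563) < log 149` (`Real.abs_log_sub_add_sum_range_le` at `x = 1/150`, 7 terms). -/
theorem log_hundredfortynine_gt : (5.00394630563 : ℝ) < Real.log 149 := by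
  have t : |((1 : ℝ) / 150)| < 1 := by rw [abs_of_pos (by norm_num)]; norm_num
  have z := Real.abs_log_sub_add_sum_range_le t 7
  rw [abs_of_pos (by norm_num : (0 : ℝ) < 1 / 150)] at z
  norm_num [Finset.sum_range_succ] at z
  have e : Real.log (149 / 150) = Real.log 149 - (Real.log 2 + Real.log 3 + 2 * Real.log 5) := by
    rw [Real.log_div (by norm_num) (by norm_num), show (150 : ℝ) = 2 * 3 * 5 ^ 2 by norm_num, Real.log_mul (by norm_num) (by norm_num), Real.log_mul (by norm_num) (by norm_num), Real.log_pow]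
    push_cast; ring
  rw [e] at z
  have h2 := Literature.Analysis.SpecialFunctions.Real.log_two_gt_d20
  have h3 := logThreeLo_le
  rw [logThreeLo] at h3
  push_cast at h3
  have h5 := logFiveLo_le
  rw [logFiveLo] at h5
  push_cast at h5
  obtain ⟨z1, z2⟩ := abs_le.1 z
  linarith

/-- `log 149 < 5.00394630624` (`Real.abs_log_sub_add_sum_range_le` at `x = 1/150`, 7 terms). -/
theorem log_hundredfortynine_lt : Real.log 149 < 5.00394630624 := by
  have t : |((1 : ℝ) / 150)| < 1 := by rw [abs_of_pos (by norm_num)]; norm_num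
  have z := Real.abs_log_sub_add_sum_range_le t 7
  rw [abs_of_pos (by norm_num : (0 : ℝ) < 1 / 150)] at z
  norm_num [Finset.sum_range_succ] at z
  have e : Real.log (149 / 150) = Real.log 149 - (Real.log 2 + Real.log 3 + 2 * Real.log 5) := by
    rw [Real.log_div (by norm_num) (by norm_num), show (150 : ℝ) = 2 * 3 * 5 ^ 2 by norm_num, Real.log_mul (by norm_num) (by norm_num), Real.log_mul (by norm_num) (by norm_num), Real.log_pow]
    push_cast; ring
  rw [e] at z
  have h2 := Literature.Analysis.SpecialFunctions.Real.log_two_lt_d20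
  have h3 := log_three_le_logThreeHi
  rw [logThreeHi] at h3
  push_cast at h3
  have h5 := log_five_le_logFiveHi
  rw [logFiveHi] at h5
  push_cast at h5
  obtain ⟨z1, z2⟩ := abs_le.1 z
  linarith

/-- lower decimal of `log 149` (fine) -/
def logHundredFortyNineLo11 : ℚ := 500394630563 / 100000000000
/-- upper decimal of `log 149` -/
def logHundredFortyNineHi11 : ℚ := 500394630624 / 100000000000
/-- `logHundredFortyNineLo11 ≤ log 149`. -/
theorem logHundredFortyNineLo11_le : (logHundredFortyNineLo11 : ℝ) ≤ Real.log 149 := by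
  rw [logHundredFortyNineLo11]; push_cast; linarith [log_hundredfortynine_gt]
/-- `log 149 ≤ logHundredFortyNineHi11`. -/
theorem log_hundredfortynine_le_logHundredFortyNineHi11 : Real.log 149 ≤ (logHundredFortyNineHi11 : ℝ) := by
  rw [logHundredFortyNineHi11]; push_cast; linarith [log_hundredfortynine_lt]
/-- `12.206555615733702 ≤ √149 ≤ 12.206555615733704`. -/
def sqrtHundredFortyNineLo : ℚ := 122065556157337029 / 10000000000000000
/-- upper decimal of `√149` -/
def sqrtHundredFortyNineHi : ℚ := 122065556157337030 / 10000000000000000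
/-- The atom `149`: weight `log 149/√149`. -/
def atomHundredFortyNine : ℕ × AtomQ :=
  (149, ⟨logHundredFortyNineLo11, logHundredFortyNineHi11, logHundredFortyNineLo11 / sqrtHundredFortyNineHi, logHundredFortyNineHi11 / sqrtHundredFortyNineLo⟩)
/-- `atomHundredFortyNine` encloses the atom `149` for any `S ∋ 149`. -/
theorem atomHundredFortyNine_encl {S : Finset ℕ} (h : 149 ∈ S) :
    (atomHundredFortyNine.2.lo : ℝ) ≤ Real.log atomHundredFortyNine.1 ∧ Real.log atomHundredFortyNine.1 ≤ (atomHundredFortyNine.2.hi : ℝ) ∧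
      (atomHundredFortyNine.2.wlo : ℝ) ≤ weilSemilocalCoeff S atomHundredFortyNine.1 ∧
      weilSemilocalCoeff S atomHundredFortyNine.1 ≤ (atomHundredFortyNine.2.whi : ℝ) := by
  simp only [atomHundredFortyNine]
  push_cast
  have h0 := prime_atom_encl (by norm_num : Nat.Prime 149) h (lo := logHundredFortyNineLo11) (hi := logHundredFortyNineHi11)
    (slo := sqrtHundredFortyNineLo) (shi := sqrtHundredFortyNineHi) (by exact_mod_cast logHundredFortyNineLo11_le)
    (by exact_mod_cast log_hundredfortynine_le_logHundredFortyNineHi11) (by rw [logHundredFortyNineLo11]; norm_num)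
    (ratCast_le_sqrt (by rw [sqrtHundredFortyNineLo]; norm_num) (by rw [sqrtHundredFortyNineLo]; norm_num))
    (sqrt_le_ratCast (by rw [sqrtHundredFortyNineHi]; norm_num) (by rw [sqrtHundredFortyNineHi]; norm_num))
    (by rw [sqrtHundredFortyNineLo]; norm_num)
  push_cast at h0
  exact h0

/-! ### The atom `151` (`log 151` from `151 = 150·(1 + 1/150)`) -/

/-- `(5.01727983650) < log 151` (`Real.abs_log_sub_add_sum_range_le` at `x = -1/150`, 7 terms). -/
theorem log_hundredfiftyone_gt : (5.01727983650 : ℝ) < Real.log 151 := by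
  have t : |(-(1 : ℝ) / 150)| < 1 := by rw [abs_of_neg (by norm_num)]; norm_num
  have z := Real.abs_log_sub_add_sum_range_le t 7
  rw [show |(-(1 : ℝ) / 150)| = 1 / 150 by rw [abs_of_neg (by norm_num)]; norm_num] at z
  norm_num [Finset.sum_range_succ] at z
  have e : Real.log (151 / 150) = Real.log 151 - (Real.log 2 + Real.log 3 + 2 * Real.log 5) := by
    rw [Real.log_div (by norm_num) (by norm_num), show (150 : ℝ) = 2 * 3 * 5 ^ 2 by norm_num, Real.log_mul (by norm_num) (by norm_num), Real.log_mul (by norm_num) (by norm_num), Real.log_pow]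
    push_cast; ring
  rw [e] at z
  have h2 := Literature.Analysis.SpecialFunctions.Real.log_two_gt_d20
  have h3 := logThreeLo_le
  rw [logThreeLo] at h3
  push_cast at h3
  have h5 := logFiveLo_le
  rw [logFiveLo] at h5
  push_cast at h5
  obtain ⟨z1, z2⟩ := abs_le.1 z
  linarith

/-- `log 151 < 5.01727983711` (`Real.abs_log_sub_add_sum_range_le` at `x = -1/150`, 7 terms). -/
theorem log_hundredfiftyone_lt : Real.log 151 < 5.01727983711 := by
  have t : |(-(1 : ℝ) / 150)| < 1 := by rw [abs_of_neg (by norm_num)]; norm_num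
  have z := Real.abs_log_sub_add_sum_range_le t 7
  rw [show |(-(1 : ℝ) / 150)| = 1 / 150 by rw [abs_of_neg (by norm_num)]; norm_num] at z
  norm_num [Finset.sum_range_succ] at z
  have e : Real.log (151 / 150) = Real.log 151 - (Real.log 2 + Real.log 3 + 2 * Real.log 5) := by
    rw [Real.log_div (by norm_num) (by norm_num), show (150 : ℝ) = 2 * 3 * 5 ^ 2 by norm_num, Real.log_mul (by norm_num) (by norm_num), Real.log_mul (by norm_num) (by norm_num), Real.log_pow]
    push_cast; ring
  rw [e] at z
  have h2 := Literature.Analysis.SpecialFunctions.Real.log_two_lt_d20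
  have h3 := log_three_le_logThreeHi
  rw [logThreeHi] at h3
  push_cast at h3
  have h5 := log_five_le_logFiveHi
  rw [logFiveHi] at h5
  push_cast at h5
  obtain ⟨z1, z2⟩ := abs_le.1 z
  linarith

/-- lower decimal of `log 151` (fine) -/
def logHundredFiftyOneLo11 : ℚ := 501727983650 / 100000000000
/-- upper decimal of `log 151` -/
def logHundredFiftyOneHi11 : ℚ := 501727983711 / 100000000000
/-- `logHundredFiftyOneLo11 ≤ log 151`. -/
theorem logHundredFiftyOneLo11_le : (logHundredFiftyOneLo11 : ℝ) ≤ Real.log 151 := by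
  rw [logHundredFiftyOneLo11]; push_cast; linarith [log_hundredfiftyone_gt]
/-- `log 151 ≤ logHundredFiftyOneHi11`. -/
theorem log_hundredfiftyone_le_logHundredFiftyOneHi11 : Real.log 151 ≤ (logHundredFiftyOneHi11 : ℝ) := by
  rw [logHundredFiftyOneHi11]; push_cast; linarith [log_hundredfiftyone_lt]
/-- `12.288205727444508 ≤ √151 ≤ 12.288205727444508`. -/
def sqrtHundredFiftyOneLo : ℚ := 122882057274445075 / 10000000000000000
/-- upper decimal of `√151` -/
def sqrtHundredFiftyOneHi : ℚ := 122882057274445076 / 10000000000000000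
/-- The atom `151`: weight `log 151/√151`. -/
def atomHundredFiftyOne : ℕ × AtomQ :=
  (151, ⟨logHundredFiftyOneLo11, logHundredFiftyOneHi11, logHundredFiftyOneLo11 / sqrtHundredFiftyOneHi, logHundredFiftyOneHi11 / sqrtHundredFiftyOneLo⟩)
/-- `atomHundredFiftyOne` encloses the atom `151` for any `S ∋ 151`. -/
theorem atomHundredFiftyOne_encl {S : Finset ℕ} (h : 151 ∈ S) :
    (atomHundredFiftyOne.2.lo : ℝ) ≤ Real.log atomHundredFiftyOne.1 ∧ Real.log atomHundredFiftyOne.1 ≤ (atomHundredFiftyOne.2.hi : ℝ) ∧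
      (atomHundredFiftyOne.2.wlo : ℝ) ≤ weilSemilocalCoeff S atomHundredFiftyOne.1 ∧
      weilSemilocalCoeff S atomHundredFiftyOne.1 ≤ (atomHundredFiftyOne.2.whi : ℝ) := by
  simp only [atomHundredFiftyOne]
  push_cast
  have h0 := prime_atom_encl (by norm_num : Nat.Prime 151) h (lo := logHundredFiftyOneLo11) (hi := logHundredFiftyOneHi11)
    (slo := sqrtHundredFiftyOneLo) (shi := sqrtHundredFiftyOneHi) (by exact_mod_cast logHundredFiftyOneLo11_le)
    (by exact_mod_cast log_hundredfiftyone_le_logHundredFiftyOneHi11) (by rw [logHundredFiftyOneLo11]; norm_num)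
    (ratCast_le_sqrt (by rw [sqrtHundredFiftyOneLo]; norm_num) (by rw [sqrtHundredFiftyOneLo]; norm_num))
    (sqrt_le_ratCast (by rw [sqrtHundredFiftyOneHi]; norm_num) (by rw [sqrtHundredFiftyOneHi]; norm_num))
    (by rw [sqrtHundredFiftyOneLo]; norm_num)
  push_cast at h0
  exact h0

end Summit.RiemannHypothesis.RiemannHypothesis.Theorems.SemilocalPolyWitness

end
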